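/-
Copyright: harness cell b2b-lgcu-borel (gen 27).  Honest framing: the VALUE here is a THEOREM
(a structural law constraining every hypothetical witness of the crux `SubgroupIdentityDesigns`) —
NOT summit progress; the crux item (stmt-MatrixMultiplication-14079) stays open and untouched.
-/
import Mathlib
import Summits.MatrixMultiplication.MatrixMultiplication.Theorems.SubgroupIdentityDesigns.Negative.FreeModuleLaw
import Summits.MatrixMultiplication.MatrixMultiplication.Theorems.SubgroupIdentityDesigns.Negative.LevelOneInvariantDim
import Summits.MatrixMultiplication.MatrixMultiplication.Theorems.SubgroupIdentityDesigns.Negative.ScalarBlockLevel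
import Summits.MatrixMultiplication.MatrixMultiplication.Theorems.SubgroupIdentityDesigns.Negative.ScalarNeumannLaw
import Summits.MatrixMultiplication.MatrixMultiplication.Theorems.SubgroupIdentityDesigns.Negative.PackingBridge

/-!
# The kernel orbit law: `|K| · dim (F_k)^K ≤ Σ_{κ ∈ K} #Fix_k(κ)` and the pair-level kernel law

Route `LevelGradedCohnUmans`, crux `SubgroupIdentityDesigns`, negative side; every level `k`,
every `m`, every prime `p`.  Report: `run/shared/lean/b2b/levelgraded-cu/ORACLE-g27.md` §G27-10
(successor item S-36).

`ScalarBlockLevel.card_mul_finrank_invRight_le` bounds the right-`K`-invariants of the level-`k`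
space `F_k ≤ ℂ[GL_m(𝔽_p)]` by the number of `K`-orbits on the modes `{M : rk M ≤ k}` and then
EVALUATES the orbit count for a semiregular `K` (in practice: scalar `K`).  This file exports the
general BURNSIDE FORM, with no hypothesis on `K`:

* `card_mul_finrank_le_sum_fixed` : `|K| · dim (F_k)^K ≤ Σ_{κ ∈ K} #{M : rk M ≤ k, κ M = M}`.

Combined with the (already hypothesis-light) right form of the scalar Neumann law
`ScalarNeumannLaw.law_right_mul` — which needs only `K ≤ H₃` and `[K, H₂] = 1`, not `K` scalar —
this gives the **PAIR-LEVEL KERNEL LAW**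

* `kernel_law_right` : for every level-`k` witness `(H₁, H₂, H₃)` of the crux in `GL_m(𝔽_p)` and
  every subgroup `K ≤ H₃` commuting elementwise with `H₂`,
  `|H₁| |H₃| + |K| · |H₁| (|H₂| − 1) ≤ Σ_{κ ∈ K} #Fix_k(κ)`,
  where `#Fix_k(κ) = #{M : rk M ≤ k, κ M = M}` (at level one `#Fix_1(κ) = 1 + b (p^{dim ker(κ−1)} − 1)`,
  `b = #ℙ(𝔽_p^m)`): a law usable with the class data of the PAIR `(H₂, H₃)` (the centraliser
  `C_{H₃}(H₂)` and its eigenvalue-1 multiplicities), for NON-scalar kernels — unipotent or toral;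

* `kernel_levelOne_right` : the level-one form for a kernel `K ≤ H₃ ∩ C(H₂)` acting fixed-point-freely
  on `𝔽_p^m ∖ 0`: `x z + s x (y − 1) + s (b − 1) ≤ (p − 1) b²`, `s = |K|` — the scalar Neumann law
  `ScalarNeumannLaw.levelOne_right` verbatim with "scalar" weakened to "fixed-point-free and
  commuting with `H₂`" (e.g. a Singer-type cyclic subgroup of `H₃` centralised by `H₂`).

Sorry-free; standard axioms; no new definitions.
-/

set_option linter.dupNamespace false

noncomputable section

open scoped BigOperators Classical Matrix LinearAlgebra.Projectivization
open Module (finrank)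

namespace Summit.MatrixMultiplication.MatrixMultiplication.Theorems.SubgroupIdentityDesigns.Negative
namespace KernelOrbitLaw

open Literature.Barriers.MatrixMultiplication (SubgroupTPP)
open Summit.MatrixMultiplication.MatrixMultiplication.Theorems.LieRankDesigns.Negative (GLm Mat)
open Summit.MatrixMultiplication.MatrixMultiplication.Theorems.LevelOneGL2Designs.Negative
  (levelMap levelSubmodule levelSubmodule_bi_inv)
open FreeModuleLaw (invRight mem_invRight invRight_le)
open LevelOneInvariantDim (avgR avgR_apply mem_of_avgR_mem)
open ScalarBlockLevel (avgR_levelMap)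
open PackingBridge (exists_test)

variable {p m : ℕ} [hp : Fact p.Prime] {k : ℕ}

/-! ## The Burnside form of the mode-orbit bound -/

/-- **KERNEL ORBIT LAW.**  For every level `k` and EVERY subgroup `K ≤ GL_m(𝔽_p)`:
`|K| · dim (F_k)^K ≤ Σ_{κ ∈ K} #{M : rk M ≤ k, κ M = M}`  (`= |K| · #(K-orbits on the modes)` by
Burnside's lemma; `dim (F_k)^K ≤ #orbits` because the right `K`-average of a mode character is the
orbit sum, which depends only on the orbit). -/
theorem card_mul_finrank_le_sum_fixed (K : Subgroup (GLm p m)) :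
    Nat.card K * finrank ℂ (invRight K (levelSubmodule p m k)) ≤
      ∑ κ : K, Fintype.card
        {M : {M : Mat p m // M.rank ≤ k} // ((κ : GLm p m) : Mat p m) * M.1 = M.1} := by
  -- the left action of `GL_m(𝔽_p)` (hence of `K`) on the modes
  letI inst : MulAction (GLm p m) {M : Mat p m // M.rank ≤ k} :=
    { smul := fun g M => ⟨(g : Mat p m) * M.1, (Matrix.rank_mul_le_right _ _).trans M.2⟩
      one_smul := fun M => Subtype.ext (by
        show ((1 : GLm p m) : Mat p m) * M.1 = M.1
        simp)
      mul_smul := fun g h M => Subtype.ext (by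
        show ((g * h : GLm p m) : Mat p m) * M.1 = (g : Mat p m) * ((h : Mat p m) * M.1)
        simp [Matrix.mul_assoc]) }
  have hsmul : ∀ (κ : K) (M : {M : Mat p m // M.rank ≤ k}),
      ((κ • M : {M : Mat p m // M.rank ≤ k}) : Mat p m) = ((κ : GLm p m) : Mat p m) * M.1 :=
    fun _ _ => rfl
  -- the averaged mode characters and their orbit invariance
  let Φ : {M : Mat p m // M.rank ≤ k} → (GLm p m → ℂ) := fun M g =>
    ∑ κ : K, ZMod.stdAddChar (Matrix.trace (((κ : GLm p m) : Mat p m) * M.1 * (g : Mat p m)))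
  have hΦ : ∀ (M : {M : Mat p m // M.rank ≤ k}) (g : GLm p m), Φ M g =
      ∑ κ : K, ZMod.stdAddChar (Matrix.trace
        (((κ • M : {M : Mat p m // M.rank ≤ k}) : Mat p m) * (g : Mat p m))) := fun M g => rfl
  have hΦsmul : ∀ (κ₀ : K) (M : {M : Mat p m // M.rank ≤ k}), Φ (κ₀ • M) = Φ M := by
    intro κ₀ M
    funext g
    rw [hΦ, hΦ]
    exact Fintype.sum_equiv (Equiv.mulRight κ₀) _ _ fun κ => by
      simp only [Equiv.coe_mulRight, mul_smul]
  let R := MulAction.orbitRel K {M : Mat p m // M.rank ≤ k}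
  have hΦout : ∀ M : {M : Mat p m // M.rank ≤ k},
      Φ M = Φ (Quotient.out (Quotient.mk R M)) := by
    intro M
    obtain ⟨κ, hκ⟩ := MulAction.mem_orbit_iff.1 (MulAction.orbitRel_apply.1 (Quotient.exact
      (Quotient.out_eq (Quotient.mk R M))))
    rw [← hκ, hΦsmul]
  -- `(F_k)^K ≤ span {Φ ω.out}`
  have hle : invRight K (levelSubmodule p m k) ≤
      Submodule.span ℂ (Set.range fun ω : Quotient R => Φ ω.out) := by
    intro f hf
    have hfJ : f ∈ levelSubmodule p m k := invRight_le K _ hf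
    obtain ⟨c, rfl⟩ := (LinearMap.mem_range).1 hfJ
    refine mem_of_avgR_mem hf ?_
    have havg : avgR K (levelMap p m k c) = ∑ M : {M : Mat p m // M.rank ≤ k}, c M • Φ M := by
      rw [avgR_levelMap]
      funext g
      simp only [Finset.sum_apply, Pi.smul_apply, smul_eq_mul, Φ]
    rw [havg]
    refine Submodule.sum_mem _ fun M _ => Submodule.smul_mem _ _ ?_
    rw [hΦout M]
    exact Submodule.subset_span ⟨_, rfl⟩
  have hdim : finrank ℂ (invRight K (levelSubmodule p m k)) ≤ Fintype.card (Quotient R) :=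
    (Submodule.finrank_mono hle).trans (finrank_range_le_card _)
  -- Burnside
  have hB := MulAction.sum_card_fixedBy_eq_card_orbits_mul_card_group K {M : Mat p m // M.rank ≤ k}
  have hfix : ∀ κ : K, Fintype.card (MulAction.fixedBy {M : Mat p m // M.rank ≤ k} κ) =
      Fintype.card {M : {M : Mat p m // M.rank ≤ k} // ((κ : GLm p m) : Mat p m) * M.1 = M.1} := by
    intro κ
    refine Fintype.card_congr (Equiv.subtypeEquivRight fun M => ?_)
    rw [MulAction.mem_fixedBy, Subtype.ext_iff, hsmul]
  rw [Finset.sum_congr rfl fun κ _ => hfix κ] at hB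
  rw [hB, Nat.card_eq_fintype_card, Nat.mul_comm (Fintype.card (Quotient R))]
  exact Nat.mul_le_mul_left _ hdim

/-- Sanity link with the semiregular evaluation: the identity fixes every mode, so the `κ = 1`
term of the Burnside sum is `N_k = #{M : rk M ≤ k}`. -/
theorem card_fixed_one :
    Fintype.card {M : {M : Mat p m // M.rank ≤ k} //
        (((1 : GLm p m)) : Mat p m) * M.1 = M.1} = Fintype.card {M : Mat p m // M.rank ≤ k} :=
  Fintype.card_congr (Equiv.subtypeUnivEquiv fun M => by simp)

/-! ## The pair-level kernel law -/

section Law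

open ScalarNeumannLaw (law_right_mul)

/-- **THE PAIR-LEVEL KERNEL LAW (right form, level `k`).**  For every level-`k` witness
`(H₁, H₂, H₃)` of `SubgroupIdentityDesigns` in `GL_m(𝔽_p)` and every subgroup `K ≤ H₃` commuting
elementwise with `H₂` (e.g. `K ≤ C_{H₃}(H₂)`):
`|H₁| |H₃| + |K| · |H₁| (|H₂| − 1) ≤ Σ_{κ ∈ K} #{M : rk M ≤ k, κ M = M}`.
No hypothesis on `K` beyond the commutation: unipotent and toral kernels are allowed. -/
theorem kernel_law_right {H₁ H₂ H₃ : Subgroup (GLm p m)} (htpp : SubgroupTPP H₁ H₂ H₃)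
    (hdes : ∃ c : Mat p m → ℂ, (∀ M, k < M.rank → c M = 0) ∧
      (∑ M, c M * ZMod.stdAddChar (Matrix.trace (M * ((1 : GLm p m) : Mat p m)))) = 1 ∧
      ∀ a ∈ H₁, ∀ b ∈ H₂, ∀ g ∈ H₃, a * b * g ≠ 1 →
        (∑ M, c M * ZMod.stdAddChar (Matrix.trace (M * ((a * b * g : GLm p m) : Mat p m)))) = 0)
    {K : Subgroup (GLm p m)} (hK : K ≤ H₃) (hcomm : ∀ κ ∈ K, ∀ b ∈ H₂, κ * b = b * κ) :
    Nat.card H₁ * Nat.card H₃ + Nat.card K * (Nat.card H₁ * (Nat.card H₂ - 1)) ≤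
      ∑ κ : K, Fintype.card
        {M : {M : Mat p m // M.rank ≤ k} // ((κ : GLm p m) : Mat p m) * M.1 = M.1} := by
  obtain ⟨f, hf, h1, h0⟩ := exists_test hdes
  have h := law_right_mul (levelSubmodule p m k) levelSubmodule_bi_inv htpp hf h1 h0 hK hcomm
  exact h.trans (card_mul_finrank_le_sum_fixed K)

/-- **LEVEL ONE, fixed-point-free kernel.**  For a level-one witness (`m ≥ 1`) and a subgroup
`K ≤ H₃` of order `s` commuting elementwise with `H₂` and acting fixed-point-freely on `𝔽_p^m ∖ 0`:
`x z + s x (y − 1) + s (b − 1) ≤ (p − 1) b²`, `b = #ℙ(𝔽_p^m)` — the scalar Neumann law with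
"scalar" weakened to "fixed-point-free and centralised by `H₂`". -/
theorem kernel_levelOne_right (hm : 1 ≤ m) {H₁ H₂ H₃ : Subgroup (GLm p m)}
    (htpp : SubgroupTPP H₁ H₂ H₃)
    (hdes : ∃ c : Mat p m → ℂ, (∀ M, 1 < M.rank → c M = 0) ∧
      (∑ M, c M * ZMod.stdAddChar (Matrix.trace (M * ((1 : GLm p m) : Mat p m)))) = 1 ∧
      ∀ a ∈ H₁, ∀ b ∈ H₂, ∀ g ∈ H₃, a * b * g ≠ 1 →
        (∑ M, c M * ZMod.stdAddChar (Matrix.trace (M * ((a * b * g : GLm p m) : Mat p m)))) = 0)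
    {K : Subgroup (GLm p m)} (hK : K ≤ H₃) (hcomm : ∀ κ ∈ K, ∀ b ∈ H₂, κ * b = b * κ)
    (hfpf : ∀ κ : K, ∀ v : Fin m → ZMod p, v ≠ 0 → κ • v = v → κ = 1) :
    Nat.card H₁ * Nat.card H₃ + Nat.card K * (Nat.card H₁ * (Nat.card H₂ - 1)) +
        Nat.card K * (Nat.card (ℙ (ZMod p) (Fin m → ZMod p)) - 1) ≤
      (p - 1) * Nat.card (ℙ (ZMod p) (Fin m → ZMod p)) ^ 2 := by
  obtain ⟨f, hf, h1, h0⟩ := exists_test hdes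
  have h := law_right_mul (levelSubmodule p m 1) levelSubmodule_bi_inv htpp hf h1 h0 hK hcomm
  have hdim := LevelOneInvariantDim.card_mul_finrank_le_of_semiregular hm K hfpf
  exact le_trans (Nat.add_le_add_right h _) hdim

/-- **LEVEL `k`, semiregular kernel.**  Same with `K ≤ H₃ ∩ C(H₂)` no non-identity element of which
fixes a non-zero matrix of rank `≤ k`: `x z + s x (y − 1) + 1 ≤ N_k + s`. -/
theorem kernel_levelK_right {H₁ H₂ H₃ : Subgroup (GLm p m)} (htpp : SubgroupTPP H₁ H₂ H₃)
    (hdes : ∃ c : Mat p m → ℂ, (∀ M, k < M.rank → c M = 0) ∧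
      (∑ M, c M * ZMod.stdAddChar (Matrix.trace (M * ((1 : GLm p m) : Mat p m)))) = 1 ∧
      ∀ a ∈ H₁, ∀ b ∈ H₂, ∀ g ∈ H₃, a * b * g ≠ 1 →
        (∑ M, c M * ZMod.stdAddChar (Matrix.trace (M * ((a * b * g : GLm p m) : Mat p m)))) = 0)
    {K : Subgroup (GLm p m)} (hK : K ≤ H₃) (hcomm : ∀ κ ∈ K, ∀ b ∈ H₂, κ * b = b * κ)
    (hsemi : ∀ κ : K, ∀ M : Mat p m, M.rank ≤ k → M ≠ 0 →
      ((κ : GLm p m) : Mat p m) * M = M → κ = 1) :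
    Nat.card H₁ * Nat.card H₃ + Nat.card K * (Nat.card H₁ * (Nat.card H₂ - 1)) + 1 ≤
      Fintype.card {M : Mat p m // M.rank ≤ k} + Nat.card K := by
  obtain ⟨f, hf, h1, h0⟩ := exists_test hdes
  have h := law_right_mul (levelSubmodule p m k) levelSubmodule_bi_inv htpp hf h1 h0 hK hcomm
  have hdim := ScalarBlockLevel.card_mul_finrank_invRight_le (k := k) K hsemi
  omega

end Law

end KernelOrbitLaw
end Summit.MatrixMultiplication.MatrixMultiplication.Theorems.SubgroupIdentityDesigns.Negative

end
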